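import Summits.SmoothPoincare4.SmoothPoincare4.Theorems.SullivanDualTargetOfSympcap
import Literature.Geometry.Symplectic.GromovR4StdModel
import Mathlib.Analysis.Calculus.FDeriv.Norm
import Mathlib.Topology.MetricSpace.Thickening

/-!
# SmoothPoincare4 / SullivanDual — crux `Target` (stmt-SmoothPoincare4-7823), line `kaehler-jacket`:
# radial model and chart kit for `stub_ballExtension` (registered helper `helper_kjRadialInverse`)

Lead c6.  Two small tool kits used by the chart transfer `helper_kjCollarMap` and by the assembly
of `stub_ballExtension`:

* §1 the RADIAL MODEL `M_u(z) = e^{u(z/‖z‖)/2} z` of the star-shaped hypersurface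
  `{e^{u(θ)/2} θ}` and its inverse `M_u⁻¹(z) = e^{-u(z/‖z‖)/2} z` (explicit expressions, no
  definitions): `M_u ∘ M_u⁻¹ = id` (the registered statement `helper_kjRadialInverse`),
  `M_u⁻¹ ∘ M_u = id`, norms, smoothness off `0`, injectivity of `D(M_u⁻¹)`;
* §2 the preferred chart of the open submanifold `Σ ∖ p` at a point `q ≠ p`
  (`TopologicalSpace.Opens.chartAt_eq`: it is `(chartAt q).subtypeRestr`, reads `z ↦ e_q z.1`,
  and a closed chart-ball about `q` avoiding `p` lies in its target).

References: H. Geiges, *An Introduction to Contact Topology* (2008), proof of Lemma 5.2.4 (the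
star-shaped model); J. M. Lee, *Introduction to Smooth Manifolds* (2013), Example 1.26 (open
submanifolds).
-/

noncomputable section

set_option linter.dupNamespace false

open scoped Manifold ContDiff Topology
open Set Function Filter Metric
open Literature.Geometry.Kaehler (MForm IsSmoothForm IsClosedForm mextDeriv)
open Literature.Geometry.Symplectic (punctured InPuncturedChartBall stdSymplecticForm inversion
  invertedStdForm IsSymplecticStandardNearPoint AgreesWithInvertedChartNear)
open Literature.Topology.FourManifolds (HomotopySphere)

namespace Summit.SmoothPoincare4.SmoothPoincare4.Theorems.Target.KaehlerJacket

local notation "E4" => EuclideanSpace ℝ (Fin 4)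

/-! ## §1 The radial model and its inverse -/

/-- The direction `z/‖z‖` is invariant under positive rescaling. [folklore] -/
theorem dir_smul_of_pos {a : ℝ} (ha : 0 < a) (z : E4) : ‖a • z‖⁻¹ • (a • z) = ‖z‖⁻¹ • z := by
  by_cases hz : z = 0
  · simp [hz]
  have hn : ‖z‖ ≠ 0 := norm_ne_zero_iff.2 hz
  rw [norm_smul, Real.norm_of_nonneg ha.le, smul_smul]
  congr 1
  field_simp

/-- `M_u ∘ M_u⁻¹ = id`: `e^{u(θ)/2} (e^{-u(θ)/2} z) = z`, the direction `θ` being unchanged. [folklore] -/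
theorem radM_radMinv (u : E4 → ℝ) (z : E4) :
    Real.exp (u (‖Real.exp (-(u (‖z‖⁻¹ • z) / 2)) • z‖⁻¹ •
        (Real.exp (-(u (‖z‖⁻¹ • z) / 2)) • z)) / 2) •
      (Real.exp (-(u (‖z‖⁻¹ • z) / 2)) • z) = z := by
  rw [dir_smul_of_pos (Real.exp_pos _), smul_smul, ← Real.exp_add]
  have : u (‖z‖⁻¹ • z) / 2 + -(u (‖z‖⁻¹ • z) / 2) = 0 := by ring
  rw [this, Real.exp_zero, one_smul]

/-- `M_u⁻¹ ∘ M_u = id`. [folklore] -/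
theorem radMinv_radM (u : E4 → ℝ) (z : E4) :
    Real.exp (-(u (‖Real.exp (u (‖z‖⁻¹ • z) / 2) • z‖⁻¹ •
        (Real.exp (u (‖z‖⁻¹ • z) / 2) • z)) / 2)) •
      (Real.exp (u (‖z‖⁻¹ • z) / 2) • z) = z := by
  rw [dir_smul_of_pos (Real.exp_pos _), smul_smul, ← Real.exp_add]
  have : -(u (‖z‖⁻¹ • z) / 2) + u (‖z‖⁻¹ • z) / 2 = 0 := by ring
  rw [this, Real.exp_zero, one_smul]

/-- Norm of `M_u⁻¹ z`. [folklore] -/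
theorem norm_radMinv (u : E4 → ℝ) (z : E4) :
    ‖Real.exp (-(u (‖z‖⁻¹ • z) / 2)) • z‖ = Real.exp (-(u (‖z‖⁻¹ • z) / 2)) * ‖z‖ := by
  rw [norm_smul, Real.norm_of_nonneg (Real.exp_pos _).le]

/-- `‖M_u⁻¹ z‖ < 1 ↔ ‖z‖ < e^{u(θ)/2}` (the inside of the star-shaped hypersurface
`{e^{u(θ)/2} θ}` is the image of the open unit ball). [folklore] -/
theorem norm_radMinv_lt_one_iff (u : E4 → ℝ) (z : E4) :
    ‖Real.exp (-(u (‖z‖⁻¹ • z) / 2)) • z‖ < 1 ↔ ‖z‖ < Real.exp (u (‖z‖⁻¹ • z) / 2) := by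
  rw [norm_radMinv, Real.exp_neg, inv_mul_lt_iff₀ (Real.exp_pos _), mul_one]

/-- On the unit sphere `M_u⁻¹ (e^{u(θ)/2} θ) = θ`. [folklore] -/
theorem radMinv_model_of_norm_eq_one (u : E4 → ℝ) {θ : E4} (hθ : ‖θ‖ = 1) :
    Real.exp (-(u (‖Real.exp (u θ / 2) • θ‖⁻¹ • (Real.exp (u θ / 2) • θ)) / 2)) •
      (Real.exp (u θ / 2) • θ) = θ := by
  have h := radMinv_radM u θ
  rwa [hθ, inv_one, one_smul] at h

/-- The direction map `z ↦ z/‖z‖` is `C^∞` off the origin. [folklore] -/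
theorem contDiffAt_dir {z : E4} (hz : z ≠ 0) : ContDiffAt ℝ ∞ (fun w : E4 => ‖w‖⁻¹ • w) z :=
  ((contDiffAt_norm ℝ hz).inv (norm_ne_zero_iff.2 hz)).smul contDiffAt_id

/-- `M_u` is `C^∞` off the origin. [folklore] -/
theorem contDiffAt_radM {u : E4 → ℝ} (hu : ContDiff ℝ ∞ u) {z : E4} (hz : z ≠ 0) :
    ContDiffAt ℝ ∞ (fun w : E4 => Real.exp (u (‖w‖⁻¹ • w) / 2) • w) z :=
  ((Real.contDiff_exp.contDiffAt.comp z
    ((hu.contDiffAt.comp z (contDiffAt_dir hz)).div_const 2))).smul contDiffAt_id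

/-- `M_u⁻¹` is `C^∞` off the origin. [folklore] -/
theorem contDiffAt_radMinv {u : E4 → ℝ} (hu : ContDiff ℝ ∞ u) {z : E4} (hz : z ≠ 0) :
    ContDiffAt ℝ ∞ (fun w : E4 => Real.exp (-(u (‖w‖⁻¹ • w) / 2)) • w) z :=
  ((Real.contDiff_exp.contDiffAt.comp z
    ((hu.contDiffAt.comp z (contDiffAt_dir hz)).div_const 2).neg)).smul contDiffAt_id

/-- `M_u⁻¹ z ≠ 0` for `z ≠ 0`. [folklore] -/
theorem radMinv_ne_zero (u : E4 → ℝ) {z : E4} (hz : z ≠ 0) :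
    Real.exp (-(u (‖z‖⁻¹ • z) / 2)) • z ≠ 0 :=
  smul_ne_zero (Real.exp_pos _).ne' hz

/-- The differential of `M_u⁻¹` at `z ≠ 0` is injective (`M_u ∘ M_u⁻¹ = id` near `z`, chain
rule). [folklore] -/
theorem injective_fderiv_radMinv {u : E4 → ℝ} (hu : ContDiff ℝ ∞ u) {z : E4} (hz : z ≠ 0) :
    Injective (fderiv ℝ (fun w : E4 => Real.exp (-(u (‖w‖⁻¹ • w) / 2)) • w) z) := by
  set Minv : E4 → E4 := fun w => Real.exp (-(u (‖w‖⁻¹ • w) / 2)) • w with hMinv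
  set M : E4 → E4 := fun w => Real.exp (u (‖w‖⁻¹ • w) / 2) • w with hM
  have hcomp : ∀ w, M (Minv w) = w := fun w => radM_radMinv u w
  have hdMinv : DifferentiableAt ℝ Minv z := (contDiffAt_radMinv hu hz).differentiableAt (by simp)
  have hdM : DifferentiableAt ℝ M (Minv z) :=
    (contDiffAt_radM hu (radMinv_ne_zero u hz)).differentiableAt (by simp)
  have hchain : fderiv ℝ (M ∘ Minv) z = (fderiv ℝ M (Minv z)).comp (fderiv ℝ Minv z) :=
    fderiv_comp z hdM hdMinv
  have hid : fderiv ℝ (M ∘ Minv) z = ContinuousLinearMap.id ℝ E4 := by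
    have : (M ∘ Minv) = id := funext fun w => hcomp w
    rw [this, fderiv_id]
  intro v w hvw
  have := congrArg (fderiv ℝ M (Minv z)) hvw
  rw [← ContinuousLinearMap.comp_apply, ← ContinuousLinearMap.comp_apply, ← hchain, hid] at this
  simpa using this


/-! ## §2 The preferred chart of `Σ ∖ p` at the point `q ≠ p`

The charted-space structure of the open submanifold `punctured p` restricts the charts of `Σ`
(`TopologicalSpace.Opens.chartAt_eq`): the chart at `⟨q, _⟩` is `(chartAt q).subtypeRestr`, it
reads `z ↦ e_q z.1` (`e_q = extChartAt (𝓡 4) q`), its source is `{z | z.1 ∈ (chartAt q).source}`,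
and every point of a closed chart-ball about `q` avoiding `p` lies in its target. -/

section Chart

variable {S : HomotopySphere 4} {p q : S.carrier}

/-- The chart of `Σ ∖ p` at `q` is `z ↦ e_q z.1`. [folklore] -/
theorem chartAt_punctured_apply (hq : q ≠ p) (z : punctured p) :
    chartAt E4 (⟨q, Literature.Geometry.Symplectic.mem_punctured.2 hq⟩ : punctured p) z =
      extChartAt (𝓡 4) q z.1 :=
  rfl

/-- The source of the chart of `Σ ∖ p` at `q` is the trace of the chart source of `Σ` at `q`.
[folklore] -/
theorem mem_chartAt_punctured_source (hq : q ≠ p) {z : punctured p} :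
    z ∈ (chartAt E4 (⟨q, Literature.Geometry.Symplectic.mem_punctured.2 hq⟩ : punctured p)).source ↔
      z.1 ∈ (chartAt E4 q).source := by
  rw [TopologicalSpace.Opens.chartAt_eq, OpenPartialHomeomorph.subtypeRestr_source]
  rfl

/-- A point of a closed chart-ball about `q` that avoids `p` lies in the target of the chart of
`Σ ∖ p` at `q`, and the inverse chart there is `e_q⁻¹` (read in `Σ ∖ p`). [folklore] -/
theorem mem_chartAt_punctured_target (hq : q ≠ p) {μ' : ℝ}
    (hball : Metric.closedBall (extChartAt (𝓡 4) q q) μ' ⊆ (extChartAt (𝓡 4) q).target)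
    (havoid : ∀ y ∈ Metric.closedBall (extChartAt (𝓡 4) q q) μ', (extChartAt (𝓡 4) q).symm y ≠ p)
    {y : E4} (hy : y ∈ Metric.closedBall (extChartAt (𝓡 4) q q) μ') :
    y ∈ (chartAt E4 (⟨q, Literature.Geometry.Symplectic.mem_punctured.2 hq⟩ : punctured p)).target ∧
      ((chartAt E4 (⟨q, Literature.Geometry.Symplectic.mem_punctured.2 hq⟩ : punctured p)).symm y).1 =
        (extChartAt (𝓡 4) q).symm y ∧
      ((chartAt E4 (⟨q, Literature.Geometry.Symplectic.mem_punctured.2 hq⟩ : punctured p)).symm y).1 ∈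
        (chartAt E4 q).source ∧
      extChartAt (𝓡 4) q
        ((chartAt E4 (⟨q, Literature.Geometry.Symplectic.mem_punctured.2 hq⟩ : punctured p)).symm y).1
        = y := by
  set e := extChartAt (𝓡 4) q with he
  set xq : punctured p := ⟨q, Literature.Geometry.Symplectic.mem_punctured.2 hq⟩ with hxq
  set ch := chartAt E4 xq with hch
  have hyt : y ∈ e.target := hball hy
  have hsrc : e.symm y ∈ (chartAt E4 q).source := by
    rw [← extChartAt_source (I := 𝓡 4)]
    exact e.map_target hyt
  set xz : punctured p := ⟨e.symm y, Literature.Geometry.Symplectic.mem_punctured.2 (havoid y hy)⟩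
    with hxz
  have hxz_src : xz ∈ ch.source := (mem_chartAt_punctured_source hq).2 hsrc
  have hch_xz : ch xz = y := by
    rw [hch, chartAt_punctured_apply hq xz]
    exact e.right_inv hyt
  have hyt' : y ∈ ch.target := by
    rw [← hch_xz]
    exact ch.map_source hxz_src
  have hsymm : ch.symm y = xz := by
    rw [← hch_xz]
    exact ch.left_inv hxz_src
  refine ⟨hyt', ?_, ?_, ?_⟩
  · rw [hsymm]
  · rw [hsymm]
    exact hsrc
  · rw [hsymm]
    exact e.right_inv hyt

end Chart

/-! ## The registered statement -/

/-- **Registered helper `helper_kjRadialInverse`**: `M_u ∘ M_u⁻¹ = id` on all of `ℝ⁴`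
(the radial model of the star-shaped hypersurface `{e^{u(θ)/2} θ}` and its explicit inverse).
[folklore] -/
theorem helper_kjRadialInverse :
    ∀ (u : E4 → ℝ) (z : E4),
      Real.exp (u (‖Real.exp (-(u (‖z‖⁻¹ • z) / 2)) • z‖⁻¹ •
          (Real.exp (-(u (‖z‖⁻¹ • z) / 2)) • z)) / 2) •
        (Real.exp (-(u (‖z‖⁻¹ • z) / 2)) • z) = z :=
  radM_radMinv

end Summit.SmoothPoincare4.SmoothPoincare4.Theorems.Target.KaehlerJacket

end
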